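import Mathlib
import HarnessLib

/-!
# K1L_D (stmt-AnomalousDissipation-27980), W7 ENGINE S1b — absolute-continuity toolkit for the chain functionals

Plumbing for the W7 slot step: the chain functionals `X = Re⟪w₀, l·P₀(w₊ − w₋)⟫`, `Φ = Ẽ + εX` are built from ABSOLUTELY CONTINUOUS mode functions
(the regularity the weak-solution mode calculus S1a delivers).  Generic facts (everything proved, no definitions):
* `AbsolutelyContinuousOnInterval.comp_lipschitzWith` — post-composition with a Lipschitz map preserves absolute continuity;
* `AbsolutelyContinuousOnInterval.norm'`, `.clm_comp` — hence norms and continuous linear images of AC functions are AC;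
* `AbsolutelyContinuousOnInterval.re_inner` — `t ↦ Re⟪f t, g t⟫` is AC for AC `f, g` with values in an inner-product space
  (polarisation: `Re⟪x,y⟫ = (‖x+y‖² − ‖x−y‖²)/4`, products of AC functions are AC).
W7 assembly owner: prover ad-sawtooth-k1loc-p1 g11.  NOT a proof of the crux / of AD; rung F-D1.A0.
[cite: BedrossianCotiZelati2017, §2 (the hypocoercivity functional is differentiated along the flow)] [problem: turb]
-/

set_option linter.dupNamespace false

namespace Summit.AnomalousDissipation.AnomalousDissipation.Theorems.SolenoidalFractalHomogenisation.LagrangianStep.W7Engine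

open Set Filter Topology
open scoped InnerProductSpace NNReal

section Lipschitz

variable {X Y : Type*} [PseudoMetricSpace X] [PseudoMetricSpace Y] {f : ℝ → X} {a b : ℝ}

/-- Post-composition with a Lipschitz map preserves absolute continuity on an interval. [cite: BedrossianCotiZelati2017, §2] -/
theorem _root_.AbsolutelyContinuousOnInterval.comp_lipschitzWith {φ : X → Y} {K : ℝ≥0} (hφ : LipschitzWith K φ)
    (hf : AbsolutelyContinuousOnInterval f a b) : AbsolutelyContinuousOnInterval (fun t => φ (f t)) a b := by
  unfold AbsolutelyContinuousOnInterval at hf ⊢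
  have hK : Tendsto (fun E : ℕ × (ℕ → ℝ × ℝ) => (K : ℝ) * ∑ i ∈ Finset.range E.1, dist (f (E.2 i).1) (f (E.2 i).2))
      (AbsolutelyContinuousOnInterval.totalLengthFilter ⊓ 𝓟 (AbsolutelyContinuousOnInterval.disjWithin a b)) (𝓝 0) := by
    simpa using hf.const_mul (K : ℝ)
  refine squeeze_zero (fun E => Finset.sum_nonneg fun i _ => dist_nonneg) (fun E => ?_) hK
  rw [Finset.mul_sum]
  exact Finset.sum_le_sum fun i _ => hφ.dist_le_mul _ _

end Lipschitz

section Normed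

variable {F G : Type*} [NormedAddCommGroup F] [NormedSpace ℝ F] [NormedAddCommGroup G] [NormedSpace ℝ G]
  {f g : ℝ → F} {a b : ℝ}

omit [NormedSpace ℝ F] in
/-- The norm of an absolutely continuous function is absolutely continuous. [cite: BedrossianCotiZelati2017, §2] -/
theorem _root_.AbsolutelyContinuousOnInterval.norm' (hf : AbsolutelyContinuousOnInterval f a b) :
    AbsolutelyContinuousOnInterval (fun t => ‖f t‖) a b :=
  hf.comp_lipschitzWith lipschitzWith_one_norm

/-- A continuous (real-)linear image of an absolutely continuous function is absolutely continuous. [cite: BedrossianCotiZelati2017, §2] -/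
theorem _root_.AbsolutelyContinuousOnInterval.clm_comp (L : F →L[ℝ] G) (hf : AbsolutelyContinuousOnInterval f a b) :
    AbsolutelyContinuousOnInterval (fun t => L (f t)) a b :=
  hf.comp_lipschitzWith L.lipschitz

omit [NormedSpace ℝ F] in
/-- The square of the norm of an absolutely continuous function is absolutely continuous. [cite: BedrossianCotiZelati2017, §2] -/
theorem _root_.AbsolutelyContinuousOnInterval.norm_sq (hf : AbsolutelyContinuousOnInterval f a b) :
    AbsolutelyContinuousOnInterval (fun t => ‖f t‖ ^ 2) a b := by
  have h := hf.norm'.fun_mul hf.norm'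
  simpa [sq] using h

end Normed

section Inner

variable {𝕜 E : Type*} [RCLike 𝕜] [NormedAddCommGroup E] [InnerProductSpace 𝕜 E] {f g : ℝ → E} {a b : ℝ}

/-- **The real part of the inner product of two absolutely continuous functions is absolutely continuous**
(polarisation `Re⟪x, y⟫ = (‖x + y‖² − ‖x − y‖²)/4`; sums, norms and products of AC functions are AC).
[cite: BedrossianCotiZelati2017, §2] -/
theorem _root_.AbsolutelyContinuousOnInterval.re_inner (hf : AbsolutelyContinuousOnInterval f a b)
    (hg : AbsolutelyContinuousOnInterval g a b) :
    AbsolutelyContinuousOnInterval (fun t => RCLike.re ⟪f t, g t⟫_𝕜) a b := by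
  letI : NormedSpace ℝ E := NormedSpace.restrictScalars ℝ 𝕜 E
  have h1 : AbsolutelyContinuousOnInterval (fun t => ‖f t + g t‖ * ‖f t + g t‖) a b :=
    (hf.fun_add hg).norm'.fun_mul (hf.fun_add hg).norm'
  have h2 : AbsolutelyContinuousOnInterval (fun t => ‖f t - g t‖ * ‖f t - g t‖) a b :=
    (hf.fun_sub hg).norm'.fun_mul (hf.fun_sub hg).norm'
  have h := (h1.fun_sub h2).const_mul (1 / 4 : ℝ)
  refine (absolutelyContinuousOnInterval_iff _ _ _).2 fun ε hε => ?_
  obtain ⟨δ, hδ, H⟩ := (absolutelyContinuousOnInterval_iff _ _ _).1 h ε hε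
  refine ⟨δ, hδ, fun E hE hs => ?_⟩
  have key : ∀ t, RCLike.re ⟪f t, g t⟫_𝕜 = (1 / 4 : ℝ) * (‖f t + g t‖ * ‖f t + g t‖ - ‖f t - g t‖ * ‖f t - g t‖) := by
    intro t
    rw [re_inner_eq_norm_add_mul_self_sub_norm_sub_mul_self_div_four]
    ring
  simp only [key]
  exact H E hE hs

end Inner

end Summit.AnomalousDissipation.AnomalousDissipation.Theorems.SolenoidalFractalHomogenisation.LagrangianStep.W7Engine
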